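import Literature.AlgebraicGeometry.Modules.ProjectionFormulaLocallyFree
import HarnessLib

/-!
# The internal adjunction isomorphism `𝓗om(A, q_*N) ≅ q_*𝓗om(q^*A, N)` for ARBITRARY `A`
# (The Stacks Project, Tag 01CM; Görtz–Wedhorn I, (7.8.3))

Layer `Literature/AlgebraicGeometry/Modules` (0 named facts, no definitions, no instances, no notation).
For a morphism of schemes `q : X ⟶ Y`, an `𝒪_Y`-module `A` and an `𝒪_X`-module `N`, the tree's comparison

  `c = sheafHomAdjunctionComparison q A N : 𝓗om(A, q_*N) ⟶ q_*𝓗om(q^*A, N)`,  `φ ↦ ε_N| ∘ q^*φ`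

(`Modules/ProjectionFormulaLocallyFree` §1, natural in `N`) was proved there to be an isomorphism when `A` is finite
locally free (frame splitting). Here it is proved to be an isomorphism for EVERY `A` — the sheafified form of the
adjunction `q^* ⊣ q_*` ("`f_*𝓗om(f^*𝒢, 𝓕) = 𝓗om(𝒢, f_*𝓕)`"): on the sections over an open `U ⊆ Y`, `c_U` is the map

  `Hom(A|_U, (q_*N)|_U) → Hom((q^*A)|_{q⁻¹U}, N|_{q⁻¹U})`,  `φ ↦ ε| ∘ q^*φ`,

* INJECTIVE, because `(ε| ∘ q^*φ)(η(a)) = φ(a)` on every pulled-back section `η(a)`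
  (`appLE_sheafHomAdjunctionComparison_app_unitSection`) and a morphism `A|_U → (q_*N)|_U` is determined by its values
  (`hom_ext_of_appLE`);
* SURJECTIVE, with the explicit preimage `ψ ↦ (a ↦ ψ(η(a)))` of `ψ : (q^*A)|_{q⁻¹U} → N|_{q⁻¹U}` (a morphism
  `A|_U → (q_*N)|_U` built from sectionwise data, `Modules/SheafHomPushforward.overHomMk'`; `η` is additive,
  `q♯`-semilinear and compatible with restriction, `Modules/PullbackUnitSections`), because a morphism out of
  `(q^*A)|_{q⁻¹U}` is determined by its values on the `η(a)` (`hom_ext_of_appLE_unitSection`).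

* §1 `sheafHomAdjunctionComparison_app_injective`, `sheafHomAdjunctionComparison_app_surjective`,
  **`isIso_sheafHomAdjunctionComparison'`** (bijective on all opens ⇒ isomorphism, `Modules/IsoOfSectionsOnBasis`; the
  unprimed name is the tree's finite-locally-free case),
  `nonempty_sheafHom_pushforward_natIso : 𝓗om(A, q_*(–)) ≅ q_*𝓗om(q^*A, –)` as functors `Mod(𝒪_X) ⥤ Mod(𝒪_Y)`.

This is brick (G2) of the 01CD-general price (`Modules/PullbackTensorProductHolds`: by uniqueness of left adjoints,
`(N ⊗ –) ⋙ q^* ≅ q^* ⋙ (q^*N ⊗ –)`). Everything is proved. Mathlib searched (pin): `SheafOfModules.pushforward`,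
`pullbackPushforwardAdjunction` (used); Mathlib has no internal Hom of `𝒪_X`-modules on schemes.

## References

* The Stacks Project, Tag 01CM (Modules, §17.22 Internal Hom: "`f_*𝓗om(f^*𝒢, 𝓕) = 𝓗om(𝒢, f_*𝓕)`"). [StacksProject]
* U. Görtz, T. Wedhorn, *Algebraic Geometry I: Schemes*, 2nd ed. (2020), (7.8.3), Exercise 7.20. [GortzWedhorn2020]
* R. Hartshorne, *Algebraic Geometry*, GTM 52 (1977), II.5 p. 110 (`f^* ⊣ f_*`). [Hartshorne1977]
-/

noncomputable section

-- `TopCat.Presheaf`/`Scheme.Modules` are not reducible (as in Mathlib's `AlgebraicGeometry/Modules/Sheaf.lean`).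
set_option backward.isDefEq.respectTransparency false

open CategoryTheory AlgebraicGeometry Opposite TopologicalSpace Limits

universe u

namespace Literature.AlgebraicGeometry.Modules

open Literature.AlgebraicGeometry.Motives

variable {X Y : Scheme.{u}} (q : X ⟶ Y) (A : Y.Modules) (N : X.Modules)

/-! ### §1 `c_U` is bijective on every open `U` -/

/-- **`c_U : Hom(A|_U, (q_*N)|_U) → Hom((q^*A)|_{q⁻¹U}, N|_{q⁻¹U})` is injective**: `c(φ)(η(a)) = φ(a)` and a morphism
`A|_U → (q_*N)|_U` is determined by its values on sections. [cite: GortzWedhorn2020, (7.8.3) and Exercise 7.20]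
[cite: StacksProject, Tag 01CM] -/
theorem sheafHomAdjunctionComparison_app_injective (U : Y.Opens) :
    Function.Injective ((sheafHomAdjunctionComparison q A N).app U) := by
  intro φ φ' h
  apply hom_ext_of_appLE
  intro W k a
  rw [← appLE_sheafHomAdjunctionComparison_app_unitSection q φ k a,
    ← appLE_sheafHomAdjunctionComparison_app_unitSection q φ' k a]
  exact congrArg (fun γ : Γ((Scheme.Modules.pushforward q).obj (sheafHom ((Scheme.Modules.pullback q).obj A) N), U) =>
    appLE (γ : ((Scheme.Modules.pullback q).obj A).over (q ⁻¹ᵁ U) ⟶ N.over (q ⁻¹ᵁ U))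
      ((Opens.map q.base).map k) (unitSection q A W a)) h

/-- **`c_U` is surjective**: `ψ : (q^*A)|_{q⁻¹U} → N|_{q⁻¹U}` is `c(φ)` for `φ : A|_U → (q_*N)|_U`, `φ(a) = ψ(η(a))`
(a morphism out of `(q^*A)|_{q⁻¹U}` is determined by its values on pulled-back sections).
[cite: GortzWedhorn2020, (7.8.3) and Exercise 7.20] [cite: StacksProject, Tag 01CM] -/
theorem sheafHomAdjunctionComparison_app_surjective (U : Y.Opens) :
    Function.Surjective ((sheafHomAdjunctionComparison q A N).app U) := by
  intro ψ'
  let ψ : ((Scheme.Modules.pullback q).obj A).over (q ⁻¹ᵁ U) ⟶ N.over (q ⁻¹ᵁ U) := ψ'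
  -- the preimage `φ : A|_U → (q_*N)|_U`, `a ↦ ψ(η(a))`
  let φ : A.over U ⟶ ((Scheme.Modules.pushforward q).obj N).over U :=
    overHomMk'
      (fun W k =>
        { toFun := fun a =>
            (appLE ψ ((Opens.map q.base).map k) (unitSection q A W a) : Γ(N, q ⁻¹ᵁ W))
          map_zero' := by
            change appLE ψ ((Opens.map q.base).map k) (unitSection q A W 0) = 0
            rw [show unitSection q A W 0 = 0 from map_zero _, appLE_zero_right]
          map_add' := fun a b => by
            change appLE ψ ((Opens.map q.base).map k) (unitSection q A W (a + b)) = _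
            rw [unitSection_add, appLE_add_right] })
      (fun W k r a => by
        change appLE ψ ((Opens.map q.base).map k) (unitSection q A W (r • a)) =
          q.app W r • appLE ψ ((Opens.map q.base).map k) (unitSection q A W a)
        rw [unitSection_smul, appLE_smul_right])
      (fun W V k k' l a => by
        change appLE ψ ((Opens.map q.base).map k') (unitSection q A V (A.presheaf.map l.op a)) =
          N.presheaf.map ((Opens.map q.base).map l).op (appLE ψ ((Opens.map q.base).map k) (unitSection q A W a))
        rw [unitSection_map, ← appLE_map ψ ((Opens.map q.base).map k) ((Opens.map q.base).map l)]
        exact appLE_congr_hom ψ _ _ _)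
  refine ⟨φ, ?_⟩
  change ((sheafHomAdjunctionComparison q A N).app U φ :
      ((Scheme.Modules.pullback q).obj A).over (q ⁻¹ᵁ U) ⟶ N.over (q ⁻¹ᵁ U)) = ψ
  apply hom_ext_of_appLE_unitSection
  intro W k b
  rw [appLE_sheafHomAdjunctionComparison_app_unitSection]
  rfl

/-- **The internal adjunction isomorphism: `c : 𝓗om(A, q_*N) ⟶ q_*𝓗om(q^*A, N)` is an ISOMORPHISM for every `𝒪_Y`-module
`A`** ("`f_*𝓗om(f^*𝒢, 𝓕) = 𝓗om(𝒢, f_*𝓕)`"; bijective on the sections over every open).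
[cite: StacksProject, Tag 01CM] [cite: GortzWedhorn2020, (7.8.3) and Exercise 7.20] -/
theorem isIso_sheafHomAdjunctionComparison' : IsIso (sheafHomAdjunctionComparison q A N) :=
  isIso_of_bijective_app_of_isAffineOpen _ fun U _ =>
    ⟨sheafHomAdjunctionComparison_app_injective q A N U, sheafHomAdjunctionComparison_app_surjective q A N U⟩

/-- **`𝓗om_Y(A, q_*(–)) ≅ q_*𝓗om_X(q^*A, –)` as functors `Mod(𝒪_X) ⥤ Mod(𝒪_Y)`** (components `c`, natural by
`sheafHomAdjunctionComparison_naturality`). [cite: StacksProject, Tag 01CM] [cite: GortzWedhorn2020, (7.8.3)] -/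
theorem nonempty_sheafHom_pushforward_natIso :
    Nonempty (Scheme.Modules.pushforward q ⋙ sheafHomFunctor A ≅
      sheafHomFunctor ((Scheme.Modules.pullback q).obj A) ⋙ Scheme.Modules.pushforward q) := by
  haveI := fun P => isIso_sheafHomAdjunctionComparison' q A P
  exact ⟨NatIso.ofComponents (fun P => asIso (sheafHomAdjunctionComparison q A P))
    (fun g => sheafHomAdjunctionComparison_naturality q A g)⟩

end Literature.AlgebraicGeometry.Modules

end
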